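import Literature.Probability.LatticeModels.ScalingLimit
import Mathlib.Analysis.InnerProductSpace.PiL2
import Mathlib.Analysis.SpecificLimits.Basic
import Mathlib.Topology.UniformSpace.LocallyUniformConvergence
import Mathlib.Topology.MetricSpace.ProperSpace.Lemmas
import HarnessLib

/-!
# Level distances metrising locally uniform convergence off the diagonals, for all orders at once
# (support file 2/3 of F4 `stub_clusterPointUnique`, crux `ExistsScaleCovariantLimit`, item stmt-CriticalPhenomena-1981,
# line `folded-current-repulsion`)

Route `HyperoctahedralRP` / `GaussianScaleMixture` (sub-problem `CriticalPhenomena/Ising3DConformalLimit`), crux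
`Summit.CriticalPhenomena.Ising3DConformalLimit.Theses.HyperoctahedralRP.ExistsScaleCovariantLimit`. Part B of the
reduction `item 5955 ∧ item 4659 ⟹ ClusterPointUnique` (file
`Theorems/HyperoctahedralRPExistsScaleCovariantLimitFoldedCurrentUniqueness.lean`): EXISTENCE of a countable
non-decreasing family of pseudo-metrics `D j` on `CorrFamily 3` whose convergence is EXACTLY locally uniform convergence
on `NonCoincident 3 n` for every order `n` (`exists_levelDist`) — the input shape of the abstract connectedness theorem
of `…FoldedCurrentUniquenessClusterSet.lean`.

* `exists_compact_exhaustion` — compact pieces `{x : (ℝ³)ⁿ | ‖xₐ‖ ≤ i, ‖xₐ − x_b‖ ≥ 1/(i+1) (a ≠ b)}` of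
  `NonCoincident 3 n` EXHAUSTING its compact subsets (a directed open cover of a compact set has a single member
  containing it);
* `supDist_*` — the truncated sup-distance `sup_K min 1 |S n − T n|` on a set `K` is a pseudo-metric bounded by one, and
  its convergence to zero along a sequence is uniform convergence on `K` (`tendstoUniformlyOn_of_supDist`,
  `tendsto_supDist_of_tendstoUniformlyOn`);
* `exists_levelDist` (registered sub-goal of the line) — the level distances
  `D j S T = ∑_{n, i ≤ j} sup_{K n i} min 1 |S n − T n|`:
  `(∀ j, D j (x k) S → 0) ⟺ ∀ n, TendstoLocallyUniformlyOn (x · n) (S n) atTop (NonCoincident 3 n)`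
  (`tendstoLocallyUniformlyOn_iff_forall_isCompact` on the open set `NonCoincident`, plus exhaustion).

Folklore (metrisability of compact convergence on a hemicompact open set). No definitions; no `sorry`.
-/

noncomputable section

namespace Summit.CriticalPhenomena.Ising3DConformalLimit.Cruxes.ExistsScaleCovariantLimit.FoldedCurrentRepulsion

open Filter Set
open scoped Topology

namespace Uniqueness

open Literature.Probability.LatticeModels

/-- **Exhaustion of the non-coincident configurations by compact pieces**: the sets
`{x | ‖xₐ‖ ≤ i ∧ ‖xₐ − x_b‖ ≥ 1/(i+1) for a ≠ b}` are compact, consist of non-coincident configurations, and every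
compact set of non-coincident configurations lies in one of them. [folklore] -/
theorem exists_compact_exhaustion (n : ℕ) :
    ∃ K : ℕ → Set (Fin n → EuclideanSpace ℝ (Fin 3)), (∀ i, IsCompact (K i)) ∧ (∀ i, K i ⊆ NonCoincident 3 n) ∧
      ∀ C : Set (Fin n → EuclideanSpace ℝ (Fin 3)), IsCompact C → C ⊆ NonCoincident 3 n → ∃ i, C ⊆ K i := by
  refine ⟨fun i => {x | (∀ a, ‖x a‖ ≤ i) ∧ ∀ a b, a ≠ b → 1 / ((i:ℝ) + 1) ≤ ‖x a - x b‖},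
    fun i => ?_, fun i => ?_, ?_⟩
  · -- compact: closed and bounded
    dsimp only
    apply Metric.isCompact_of_isClosed_isBounded
    · have h1 : IsClosed {x : Fin n → EuclideanSpace ℝ (Fin 3) | ∀ a, ‖x a‖ ≤ i} := by
        rw [Set.setOf_forall]
        exact isClosed_iInter fun a => isClosed_le (continuous_norm.comp (continuous_apply a)) continuous_const
      have h2 : IsClosed {x : Fin n → EuclideanSpace ℝ (Fin 3) |
          ∀ a b, a ≠ b → 1 / ((i:ℝ) + 1) ≤ ‖x a - x b‖} := by
        rw [Set.setOf_forall]
        refine isClosed_iInter fun a => ?_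
        rw [Set.setOf_forall]
        refine isClosed_iInter fun b => ?_
        by_cases hab : a = b
        · have e : {x : Fin n → EuclideanSpace ℝ (Fin 3) | a ≠ b → 1 / ((i:ℝ) + 1) ≤ ‖x a - x b‖} = Set.univ :=
            Set.eq_univ_of_forall fun x h => (h hab).elim
          rw [e]; exact isClosed_univ
        · have e : {x : Fin n → EuclideanSpace ℝ (Fin 3) | a ≠ b → 1 / ((i:ℝ) + 1) ≤ ‖x a - x b‖} =
              {x | 1 / ((i:ℝ) + 1) ≤ ‖x a - x b‖} := by
            ext x; simp [hab]
          rw [e]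
          exact isClosed_le continuous_const ((continuous_apply a).sub (continuous_apply b)).norm
      exact h1.inter h2
    · rw [Metric.isBounded_iff_subset_closedBall (0 : Fin n → EuclideanSpace ℝ (Fin 3))]
      refine ⟨i, fun x hx => ?_⟩
      rw [mem_closedBall_zero_iff]
      exact (pi_norm_le_iff_of_nonneg (by positivity)).2 hx.1
  · -- non-coincident
    intro x hx
    rw [mem_nonCoincident]
    intro a b hab
    by_contra h
    have h1 := hx.2 a b h
    rw [hab, sub_self, norm_zero] at h1
    have h2 : (0:ℝ) < 1 / ((i:ℝ) + 1) := by positivity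
    linarith
  · -- exhaustion
    intro C hC hCs
    set U : ℕ → Set (Fin n → EuclideanSpace ℝ (Fin 3)) := fun i =>
      {x | (∀ a, ‖x a‖ < i) ∧ ∀ a b, a ≠ b → 1 / ((i:ℝ) + 1) < ‖x a - x b‖} with hU
    have hUo : ∀ i, IsOpen (U i) := by
      intro i
      have h1 : IsOpen {x : Fin n → EuclideanSpace ℝ (Fin 3) | ∀ a, ‖x a‖ < i} := by
        rw [Set.setOf_forall]
        exact isOpen_iInter_of_finite fun a =>
          isOpen_lt (continuous_norm.comp (continuous_apply a)) continuous_const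
      have h2 : IsOpen {x : Fin n → EuclideanSpace ℝ (Fin 3) |
          ∀ a b, a ≠ b → 1 / ((i:ℝ) + 1) < ‖x a - x b‖} := by
        rw [Set.setOf_forall]
        refine isOpen_iInter_of_finite fun a => ?_
        rw [Set.setOf_forall]
        refine isOpen_iInter_of_finite fun b => ?_
        by_cases hab : a = b
        · have e : {x : Fin n → EuclideanSpace ℝ (Fin 3) | a ≠ b → 1 / ((i:ℝ) + 1) < ‖x a - x b‖} = Set.univ :=
            Set.eq_univ_of_forall fun x h => (h hab).elim
          rw [e]; exact isOpen_univ
        · have e : {x : Fin n → EuclideanSpace ℝ (Fin 3) | a ≠ b → 1 / ((i:ℝ) + 1) < ‖x a - x b‖} =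
              {x | 1 / ((i:ℝ) + 1) < ‖x a - x b‖} := by
            ext x; simp [hab]
          rw [e]
          exact isOpen_lt continuous_const ((continuous_apply a).sub (continuous_apply b)).norm
      exact h1.inter h2
    have hmono : Monotone U := by
      intro i i' hii' x hx
      refine ⟨fun a => (hx.1 a).trans_le (by exact_mod_cast hii'), fun a b hab => lt_of_le_of_lt ?_ (hx.2 a b hab)⟩
      gcongr
    have hcov : C ⊆ ⋃ i, U i := by
      intro x hx
      have hinj := (mem_nonCoincident x).1 (hCs hx)
      have h1 : ∀ᶠ i : ℕ in atTop, ∀ a, ‖x a‖ < i :=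
        eventually_all.2 fun a => (tendsto_natCast_atTop_atTop (R := ℝ)).eventually_gt_atTop ‖x a‖
      have h2 : ∀ᶠ i : ℕ in atTop, ∀ a b, a ≠ b → 1 / ((i:ℝ) + 1) < ‖x a - x b‖ := by
        refine eventually_all.2 fun a => eventually_all.2 fun b => ?_
        by_cases hab : a = b
        · exact Eventually.of_forall fun i h => (h hab).elim
        · have hpos : 0 < ‖x a - x b‖ := norm_pos_iff.2 (sub_ne_zero.2 (hinj.ne hab))
          exact (tendsto_one_div_add_atTop_nhds_zero_nat.eventually (gt_mem_nhds hpos)).mono fun i hi _ => hi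
      obtain ⟨i, hi1, hi2⟩ := (h1.and h2).exists
      exact Set.mem_iUnion.2 ⟨i, hi1, hi2⟩
    obtain ⟨i, hi⟩ := hC.elim_directed_cover U hUo hcov hmono.directed_le
    exact ⟨i, hi.trans fun x hx => ⟨fun a => (hx.1 a).le, fun a b hab => (hx.2 a b hab).le⟩⟩

/-- `min 1 |·−·|` is a pseudo-metric on `ℝ`. [folklore] -/
theorem min_one_abs_triangle (a b c : ℝ) : min 1 |a - c| ≤ min 1 |a - b| + min 1 |b - c| := by
  rcases le_or_gt 1 |a - b| with h1 | h1
  · rw [min_eq_left h1]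
    linarith [min_le_left 1 |a - c|, le_min zero_le_one (abs_nonneg (b - c))]
  rcases le_or_gt 1 |b - c| with h2 | h2
  · rw [min_eq_left h2]
    linarith [min_le_left 1 |a - c|, le_min zero_le_one (abs_nonneg (a - b))]
  rw [min_eq_right h1.le, min_eq_right h2.le]
  exact (min_le_right _ _).trans (abs_sub_le a b c)

variable {n : ℕ} {K : Set (Fin n → EuclideanSpace ℝ (Fin 3))}

/-- Upper bounds of the truncated sup-distance `sup_K min 1 |S n − T n|`. [folklore] -/
theorem supDist_le {S T : CorrFamily 3} {c : ℝ} (hc : 0 ≤ c) (h : ∀ x ∈ K, min 1 |S n x - T n x| ≤ c) :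
    sSup ((fun x => min 1 |S n x - T n x|) '' K) ≤ c :=
  Real.sSup_le (by rintro _ ⟨x, hx, rfl⟩; exact h x hx) hc

/-- The truncated sup-distance dominates the pointwise truncated distance on `K`. [folklore] -/
theorem le_supDist {S T : CorrFamily 3} {x : Fin n → EuclideanSpace ℝ (Fin 3)} (hx : x ∈ K) :
    min 1 |S n x - T n x| ≤ sSup ((fun x => min 1 |S n x - T n x|) '' K) :=
  le_csSup ⟨1, by rintro _ ⟨y, _, rfl⟩; exact min_le_left _ _⟩ ⟨x, hx, rfl⟩

/-- The truncated sup-distance is nonnegative. [folklore] -/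
theorem supDist_nonneg (K : Set (Fin n → EuclideanSpace ℝ (Fin 3))) (S T : CorrFamily 3) :
    0 ≤ sSup ((fun x => min 1 |S n x - T n x|) '' K) :=
  Real.sSup_nonneg (by rintro _ ⟨y, _, rfl⟩; exact le_min zero_le_one (abs_nonneg _))

/-- The truncated sup-distance vanishes on the diagonal. [folklore] -/
theorem supDist_self (K : Set (Fin n → EuclideanSpace ℝ (Fin 3))) (S : CorrFamily 3) :
    sSup ((fun x => min 1 |S n x - S n x|) '' K) = 0 :=
  le_antisymm (supDist_le le_rfl fun _ _ => by simp) (supDist_nonneg K S S)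

/-- The truncated sup-distance is symmetric. [folklore] -/
theorem supDist_comm (K : Set (Fin n → EuclideanSpace ℝ (Fin 3))) (S T : CorrFamily 3) :
    sSup ((fun x => min 1 |S n x - T n x|) '' K) = sSup ((fun x => min 1 |T n x - S n x|) '' K) := by
  simp_rw [abs_sub_comm (S n _) (T n _)]

/-- Triangle inequality for the truncated sup-distance. [folklore] -/
theorem supDist_triangle (K : Set (Fin n → EuclideanSpace ℝ (Fin 3))) (S T U : CorrFamily 3) :
    sSup ((fun x => min 1 |S n x - U n x|) '' K) ≤
      sSup ((fun x => min 1 |S n x - T n x|) '' K) + sSup ((fun x => min 1 |T n x - U n x|) '' K) :=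
  supDist_le (add_nonneg (supDist_nonneg _ _ _) (supDist_nonneg _ _ _)) fun _ hx =>
    (min_one_abs_triangle _ _ _).trans (add_le_add (le_supDist hx) (le_supDist hx))

/-- Convergence of the truncated sup-distances to zero gives uniform convergence on `K`. [folklore] -/
theorem tendstoUniformlyOn_of_supDist {x : ℕ → CorrFamily 3} {S : CorrFamily 3}
    (h : Tendsto (fun k => sSup ((fun z => min 1 |x k n z - S n z|) '' K)) atTop (𝓝 0)) :
    TendstoUniformlyOn (fun k => x k n) (S n) atTop K := by
  rw [Metric.tendstoUniformlyOn_iff]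
  intro ε hε
  have hε' : 0 < min ε 1 := lt_min hε one_pos
  filter_upwards [(tendsto_order.1 h).2 _ hε'] with k hk y hy
  have h1 : min 1 |x k n y - S n y| < min ε 1 := lt_of_le_of_lt (le_supDist hy) hk
  have h2 : |x k n y - S n y| < min ε 1 := by
    rcases le_or_gt 1 |x k n y - S n y| with h3 | h3
    · rw [min_eq_left h3] at h1
      exact absurd (min_le_right ε 1) (not_le.2 h1)
    · rwa [min_eq_right h3.le] at h1
  rw [Real.dist_eq, abs_sub_comm]
  exact lt_of_lt_of_le h2 (min_le_left _ _)

/-- Uniform convergence on `K` gives convergence of the truncated sup-distances to zero. [folklore] -/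
theorem tendsto_supDist_of_tendstoUniformlyOn {x : ℕ → CorrFamily 3} {S : CorrFamily 3}
    (h : TendstoUniformlyOn (fun k => x k n) (S n) atTop K) :
    Tendsto (fun k => sSup ((fun z => min 1 |x k n z - S n z|) '' K)) atTop (𝓝 0) := by
  rw [Metric.tendstoUniformlyOn_iff] at h
  rw [Metric.tendsto_nhds]
  intro ε hε
  filter_upwards [h (ε / 2) (by positivity)] with k hk
  rw [Real.dist_0_eq_abs, abs_of_nonneg (supDist_nonneg _ _ _)]
  refine lt_of_le_of_lt (supDist_le (by positivity) fun y hy => ?_) (half_lt_self hε)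
  have h1 := hk y hy
  rw [Real.dist_eq, abs_sub_comm] at h1
  exact (min_le_right _ _).trans h1.le

/-- **The level distances.** There is a family `D j` of pseudo-metrics on `CorrFamily 3`, non-decreasing in `j`, whose
convergence along a sequence is EXACTLY locally uniform convergence on `NonCoincident 3 n` for every order `n`:
`D j S T = ∑_{n, i ≤ j} sup_{K n i} min 1 |S n − T n|` for the compact exhaustions `K n i` of
`exists_compact_exhaustion`. [folklore] -/
theorem exists_levelDist :
    ∃ D : ℕ → CorrFamily 3 → CorrFamily 3 → ℝ, (∀ j S, D j S S = 0) ∧ (∀ j S T, D j S T = D j T S) ∧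
      (∀ j S T U, D j S U ≤ D j S T + D j T U) ∧ (∀ S T, Monotone fun j => D j S T) ∧
      ∀ (x : ℕ → CorrFamily 3) (S : CorrFamily 3),
        (∀ j, Filter.Tendsto (fun k => D j (x k) S) Filter.atTop (nhds 0)) ↔
          ∀ n, TendstoLocallyUniformlyOn (fun k => x k n) (S n) Filter.atTop (NonCoincident 3 n) := by
  choose K hKc hKs hKe using exists_compact_exhaustion
  refine ⟨fun j S T => ∑ p ∈ Finset.range (j + 1) ×ˢ Finset.range (j + 1),
    sSup ((fun x => min 1 |S p.1 x - T p.1 x|) '' K p.1 p.2), ?_, ?_, ?_, ?_, ?_⟩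
  · intro j S
    exact Finset.sum_eq_zero fun _ _ => supDist_self _ _
  · intro j S T
    exact Finset.sum_congr rfl fun _ _ => supDist_comm _ _ _
  · intro j S T U
    dsimp only
    rw [← Finset.sum_add_distrib]
    exact Finset.sum_le_sum fun _ _ => supDist_triangle _ _ _ _
  · intro S T j j' hjj'
    refine Finset.sum_le_sum_of_subset_of_nonneg ?_ fun _ _ _ => supDist_nonneg _ _ _
    exact Finset.product_subset_product (Finset.range_mono (by omega)) (Finset.range_mono (by omega))
  · intro x S
    constructor
    · intro h n
      rw [tendstoLocallyUniformlyOn_iff_forall_isCompact (isOpen_nonCoincident 3 n)]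
      intro C hC hCc
      obtain ⟨i, hi⟩ := hKe n C hCc hC
      have hmem : (n, i) ∈ Finset.range (max n i + 1) ×ˢ Finset.range (max n i + 1) := by
        simp only [Finset.mem_product, Finset.mem_range]
        omega
      have h1 : Tendsto (fun k => sSup ((fun z => min 1 |x k n z - S n z|) '' K n i)) atTop (𝓝 0) := by
        refine squeeze_zero (fun k => supDist_nonneg _ _ _) (fun k => ?_) (h (max n i))
        exact Finset.single_le_sum
          (f := fun p : ℕ × ℕ => sSup ((fun z => min 1 |x k p.1 z - S p.1 z|) '' K p.1 p.2))
          (fun _ _ => supDist_nonneg _ _ _) hmem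
      exact (tendstoUniformlyOn_of_supDist h1).mono hi
    · intro h j
      have h0 := tendsto_finsetSum (Finset.range (j + 1) ×ˢ Finset.range (j + 1)) fun p _ =>
        tendsto_supDist_of_tendstoUniformlyOn
          ((tendstoLocallyUniformlyOn_iff_forall_isCompact (isOpen_nonCoincident 3 p.1)).1 (h p.1)
            (K p.1 p.2) (hKs p.1 p.2) (hKc p.1 p.2)) (x := x) (S := S)
      rw [Finset.sum_const_zero] at h0
      exact h0

end Uniqueness

end Summit.CriticalPhenomena.Ising3DConformalLimit.Cruxes.ExistsScaleCovariantLimit.FoldedCurrentRepulsion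

end
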